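import Summits.CriticalPhenomena.CardyFormulaZ2.Theorems.CardyBoundaryCoulombGasBoundaryDefectGaussianRStubReferenceLimitPart2

/-!
# Stub `stub_realisability` of line `rainbow-monomials-in-excursion-kernels` — Part 7:
# declarative semantics of the jump collar `LegInsertionData.collar` (arc, pockets, `faceH`, `vertH`)
# (crux `BoundaryDefectGaussianR`, stmt-CriticalPhenomena-14132; insertion dictionary D2)

`Literature.Probability.LatticeModels.CollarLegModel.LegInsertionData.collar` is ALGORITHMIC: a
`List.filter`/`List.find?`/`List.findSome?` over the annotated counter-clockwise boundary walk
`ι.walk V`. Every step of the insertion dictionary D2 (heights ↦ arrows, strands cut at the collar's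
jump edges and junctions, forced orientations, phases) reads the collar through the position `t`
along the walk. This file provides that reading. Notation: `outDart V ι.sink = some d₀`,
`ds = cycle V d₀` (the `P = ds.length` boundary darts), and `st t` = the walk state after `t` darts,
i.e. `st t = List.foldl (fun s d ↦ s.step (ι.startAt V d)) ι.init (ds.take t)` (taken as a
hypothesis `hst` on an auxiliary `st : ℕ → WalkState`, discharged by `fun _ ↦ rfl`); entry `t` of
the walk is `(ds[t], st t, st (t + 1))` (`getElem_walk_st`).

* (A) `mem_collar_arc_iff`: `x ∈ arc ↔ ∃ t < P, (st t).wired ∨ (st (t+1)).wired, and ds[t].1 = x`;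
* (B) `mem_collar_pocket_iff`: `f ∈ pocket ↔ ∃ t < P, (st (t+1)).wired ∧ gapFace ds[t] = f`;
* (C) `collar_faceH_of_first` (the `find?`: the level after the FIRST free dart whose gap face is
  `f`), `collar_faceH_gapFace` (if all earlier free darts with the same gap face carry the same
  level — e.g. the face is met once — then `faceH (gapFace ds[t]) = (st (t+1)).level`),
  `collar_faceH_eq_zero` (default);
* (D) `mention_of_vertex`, `mention_of_pocketCorner`, `mention_eq_none_iff` (the three clauses of
  `LegInsertionData.mention`), `collar_vertH_of_first` (the `findSome?`: the value of the FIRST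
  entry mentioning `x`), `collar_vertH_eq` (all earlier mentions agree), `collar_vertH_eq_zero`.

Registered sub-goals carried here: `s12_collarArc`, `s12_collarPockets`, `s12_collarFaceH`,
`s12_collarVertH`. The level profile (E) of an ADMISSIBLE datum is Part 8 (`s12_collarLevels`).

Unit tests (exact evaluation, `#eval`, 4×2 box `V = [0,3]×[0,1]`, sink `(2,0)`, so `d₀ = ((2,0),S)`
and the walk is `(2,0)S (3,0)S (3,0)E (3,1)E (3,1)N (2,1)N (1,1)N (0,1)N (0,1)W (0,0)W (0,0)S (1,0)S`;
states printed as `(level, w/f, pending, sgn)` before `⊢` after each dart):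
```
(2;2)  source (1,0), legs 2 — admissible; st 0 = (-2,f,0,0)
  (2,0)S: (-2,f,0,0) ⊢ (0,f,0,1)   [jump edge +2, gap face (2,-1) at level 0]
  (3,0)S … (0,0)S: (0,f,0,1) ⊢ (0,f,0,1)   [free stretch at face level 0]
  (1,0)S: (0,f,0,1) ⊢ (-2,f,0,-1)  [jump edge -2, gap face (1,-1) at level -2]
  arc = ∅, pocket = ∅, faceH: (1,-1) ↦ -2, every other exterior face ↦ 0.
(1;1)  source (1,0), legs 1 — admissible; st 0 = (-1,w,0,0)
  (2,0)S: (-1,w,0,0) ⊢ (0,f,0,1)   [junction closing the wired arc: -1 → 0]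
  (3,0)S … (0,0)S: (0,f,0,1) ⊢ (0,f,0,1)   [free stretch at face level 0]
  (1,0)S: (0,f,0,1) ⊢ (-1,w,0,-1)  [junction opening the wired arc: 0 → -1]
  arc = {(2,0),(1,0)} at vertH -1, ghosts (1,-1),(2,-1) at vertH -1, pocket = {(1,-1)} (the face
  between source and sink, under the wired stretch (1,0)S·(2,0)S), faceH ↦ 0 on all other faces.
(1,1;2)  sources (1,0),(2,1), legs 1,1 — admissible; st 0 = (-2,f,0,0)
  (2,0)S: (-2,f,0,0) ⊢ (0,f,0,1) [jump +2]; (3,0)S … (3,1)N free at 0;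
  (2,1)N: (0,f,0,1) ⊢ (-1,w,0,-1) [junction 0 → -1 opens the arc]; (1,1)N … (0,0)S wired at -1;
  (1,0)S: (-1,w,0,-1) ⊢ (-2,f,0,-1) [junction -1 → -2 closes it].
  arc = {(2,1),(1,1),(0,1),(0,0),(1,0)} and all 9 ghosts at vertH -1; pockets = the six exterior
  faces from (1,1) round to (0,-1); faceH: (1,-1) ↦ -2, (2,-1),(3,-1),(3,0),(3,1),(2,1) ↦ 0.
```
-/

namespace Summit.CriticalPhenomena.CardyFormulaZ2.Cruxes.BoundaryDefectGaussianR.RainbowMonomialsInExcursionKernels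

open Literature.Probability.LatticeModels Literature.Probability.LatticeModels.CollarLegModel

/-! ### The three clauses of `mention` -/

/-- First clause of `mention`: on a wired stretch (before or after the dart), the dart's vertex and
its tip (ghost) are assigned the wired level. [folklore] -/
theorem mention_of_vertex (V : Finset (ℤ × ℤ)) {x : ℤ × ℤ} {e : Dart × WalkState × WalkState}
    (hw : e.2.1.wired = true ∨ e.2.2.wired = true) (hx : e.1.1 = x ∨ dartTip e.1 = x) :
    LegInsertionData.mention V x e =
      some (if e.2.1.wired = true then e.2.1.level else e.2.2.level) := by
  unfold LegInsertionData.mention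
  have h1 : (e.2.1.wired || e.2.2.wired) = true := by simpa [Bool.or_eq_true] using hw
  have h2 : (decide (e.1.1 = x) || decide (dartTip e.1 = x)) = true := by simpa using hx
  simp only [h1, h2, Bool.and_self, if_true]

/-- Second clause of `mention`: a lattice point outside `V` that is a corner of the pocket after a
dart on a wired stretch (and is not the dart's vertex or tip) is assigned the pocket's level.
[folklore] -/
theorem mention_of_pocketCorner (V : Finset (ℤ × ℤ)) {x : ℤ × ℤ} {e : Dart × WalkState × WalkState}
    (hx : e.1.1 ≠ x ∧ dartTip e.1 ≠ x) (hw : e.2.2.wired = true)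
    (hc : x ∈ SixVertex.faceCorners (gapFace e.1)) (hxV : x ∉ V) :
    LegInsertionData.mention V x e = some e.2.2.level := by
  unfold LegInsertionData.mention
  have h2 : (decide (e.1.1 = x) || decide (dartTip e.1 = x)) = false := by simpa using hx
  simp [h2, hw, hc, hxV]

/-- Third clause of `mention`: an entry mentions `x` iff one of the two clauses applies. [folklore] -/
theorem mention_eq_none_iff (V : Finset (ℤ × ℤ)) {x : ℤ × ℤ} {e : Dart × WalkState × WalkState} :
    LegInsertionData.mention V x e = none ↔
      ¬ ((e.2.1.wired = true ∨ e.2.2.wired = true) ∧ (e.1.1 = x ∨ dartTip e.1 = x)) ∧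
      ¬ (e.2.2.wired = true ∧ x ∈ SixVertex.faceCorners (gapFace e.1) ∧ x ∉ V) := by
  have hA : ((e.2.1.wired || e.2.2.wired) &&
      (decide (e.1.1 = x) || decide (dartTip e.1 = x))) = true ↔
      (e.2.1.wired = true ∨ e.2.2.wired = true) ∧ (e.1.1 = x ∨ dartTip e.1 = x) := by simp
  have hB : (e.2.2.wired && decide (x ∈ SixVertex.faceCorners (gapFace e.1)) &&
      decide (x ∉ V)) = true ↔
      e.2.2.wired = true ∧ x ∈ SixVertex.faceCorners (gapFace e.1) ∧ x ∉ V := by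
    simp [and_assoc]
  unfold LegInsertionData.mention
  split_ifs with h1 h2
  · simp only [false_iff]
    exact fun hn => hn.1 (hA.1 h1)
  · simp only [false_iff]
    exact fun hn => hn.2 (hB.1 h2)
  · simp only [true_iff]
    exact ⟨fun h' => h1 (hA.2 h'), fun h' => h2 (hB.2 h')⟩

/-- On a free stretch (free before and after the dart) an entry mentions nothing. [folklore] -/
theorem mention_of_free (V : Finset (ℤ × ℤ)) {x : ℤ × ℤ} {e : Dart × WalkState × WalkState}
    (h1 : e.2.1.wired = false) (h2 : e.2.2.wired = false) :
    LegInsertionData.mention V x e = none := by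
  rw [mention_eq_none_iff]
  simp [h1, h2]

/-! ### Walk entries by position -/

section Walk

variable (ι : LegInsertionData) (V : Finset (ℤ × ℤ)) {d₀ : Dart} (h : outDart V ι.sink = some d₀)
  {st : ℕ → WalkState}
  (hst : ∀ t, st t = List.foldl (fun s d => s.step (ι.startAt V d)) ι.init ((cycle V d₀).take t))
include h

/-- The walk has one entry per boundary dart (length bridge for `getElem`). [folklore] -/
theorem lt_length_walk_iff {t : ℕ} : t < (ι.walk V).length ↔ t < (cycle V d₀).length := by
  rw [length_walk ι V h]

include hst

/-- Entry `t` of the annotated walk is `(ds[t], st t, st (t + 1))`. [folklore] -/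
theorem getElem_walk_st {t : ℕ} (ht : t < (ι.walk V).length) :
    (ι.walk V)[t] = ((cycle V d₀)[t]'((lt_length_walk_iff ι V h).1 ht), st t, st (t + 1)) := by
  apply Option.some_injective
  rw [← List.getElem?_eq_getElem ht, getElem?_walk ι V h ((lt_length_walk_iff ι V h).1 ht), hst, hst]

/-- Membership in the annotated walk, by position. [folklore] -/
theorem mem_walk_iff_st {e : Dart × WalkState × WalkState} :
    e ∈ ι.walk V ↔
      ∃ (t : ℕ) (_ : t < (cycle V d₀).length), e = ((cycle V d₀)[t], st t, st (t + 1)) := by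
  rw [mem_walk_iff ι V h]
  simp only [hst]

/-! ### (A) the arc and (B) the pockets -/

/-- **(A) The Dirichlet arc.** `x` is an arc vertex of the jump collar iff it is the vertex of a
boundary dart lying on a wired stretch (wired before or after the dart). [folklore] -/
theorem mem_collar_arc_iff {x : ℤ × ℤ} :
    x ∈ (ι.collar V).arc ↔ ∃ (t : ℕ) (_ : t < (cycle V d₀).length),
      ((st t).wired = true ∨ (st (t + 1)).wired = true) ∧ ((cycle V d₀)[t]).1 = x := by
  simp only [LegInsertionData.collar, List.mem_toFinset, List.mem_map, List.mem_filter,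
    Bool.or_eq_true, mem_walk_iff_st ι V h hst]
  constructor
  · rintro ⟨e, ⟨⟨t, ht, rfl⟩, hw⟩, rfl⟩
    exact ⟨t, ht, hw, rfl⟩
  · rintro ⟨t, ht, hw, rfl⟩
    exact ⟨_, ⟨⟨t, ht, rfl⟩, hw⟩, rfl⟩

/-- **(B) The pockets.** `f` is a pocket of the jump collar iff it is the gap face after a boundary
dart whose following stretch is wired. [folklore] -/
theorem mem_collar_pocket_iff {f : ℤ × ℤ} :
    f ∈ (ι.collar V).pocket ↔ ∃ (t : ℕ) (_ : t < (cycle V d₀).length),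
      (st (t + 1)).wired = true ∧ gapFace ((cycle V d₀)[t]) = f := by
  simp only [LegInsertionData.collar, List.mem_toFinset, List.mem_map, List.mem_filter,
    mem_walk_iff_st ι V h hst]
  constructor
  · rintro ⟨e, ⟨⟨t, ht, rfl⟩, hw⟩, rfl⟩
    exact ⟨t, ht, hw, rfl⟩
  · rintro ⟨t, ht, hw, rfl⟩
    exact ⟨_, ⟨⟨t, ht, rfl⟩, hw⟩, rfl⟩

/-! ### (C) the collar face levels -/

/-- **(C) `faceH` is the level after the FIRST free dart with the given gap face.** If dart `t₀` is
followed by a free stretch and no earlier dart followed by a free stretch has the same gap face,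
then the collar assigns to `gapFace ds[t₀]` the level `(st (t₀ + 1)).level`. [folklore] -/
theorem collar_faceH_of_first {t₀ : ℕ} (ht₀ : t₀ < (cycle V d₀).length)
    (hw : (st (t₀ + 1)).wired = false)
    (hfirst : ∀ t, ∀ (ht : t < t₀), (st (t + 1)).wired = false →
      gapFace (cycle V d₀)[t] ≠ gapFace (cycle V d₀)[t₀]) :
    (ι.collar V).faceH (gapFace (cycle V d₀)[t₀]) = (st (t₀ + 1)).level := by
  have ht₀' : t₀ < (ι.walk V).length := (lt_length_walk_iff ι V h).2 ht₀
  have hfind : (ι.walk V).find?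
      (fun e => !e.2.2.wired && decide (gapFace e.1 = gapFace (cycle V d₀)[t₀])) =
      some ((cycle V d₀)[t₀], st t₀, st (t₀ + 1)) := by
    rw [List.find?_eq_some_iff_getElem]
    refine ⟨by simp [hw], t₀, ht₀', getElem_walk_st ι V h hst ht₀', fun j hj => ?_⟩
    rw [getElem_walk_st ι V h hst (by omega)]
    cases hwj : (st (j + 1)).wired
    · simpa [hwj] using hfirst j (by omega) hwj
    · simp
  simp only [LegInsertionData.collar, hfind]

/-- **(C′) `faceH` when all free darts with the same gap face agree.** If dart `t` is followed by a
free stretch and every EARLIER dart followed by a free stretch with the same gap face carries the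
same level after it (in particular if the face is met only once), then
`faceH (gapFace ds[t]) = (st (t + 1)).level`. [folklore] -/
theorem collar_faceH_gapFace {t : ℕ} (ht : t < (cycle V d₀).length) (hw : (st (t + 1)).wired = false)
    (hsame : ∀ t', ∀ (ht' : t' < t), (st (t' + 1)).wired = false →
      gapFace (cycle V d₀)[t'] = gapFace (cycle V d₀)[t] → (st (t' + 1)).level = (st (t + 1)).level) :
    (ι.collar V).faceH (gapFace (cycle V d₀)[t]) = (st (t + 1)).level := by
  induction t using Nat.strong_induction_on with
  | _ t ih =>
    by_cases hex : ∃ t', ∃ (ht' : t' < t), (st (t' + 1)).wired = false ∧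
        gapFace (cycle V d₀)[t'] = gapFace (cycle V d₀)[t]
    · obtain ⟨t', ht', hw', hg'⟩ := hex
      rw [← hg', ← hsame t' ht' hw' hg']
      refine ih t' ht' (by omega) hw' fun t'' ht'' hw'' hg'' => ?_
      rw [hsame t' ht' hw' hg']
      exact hsame t'' (by omega) hw'' (hg''.trans hg')
    · exact collar_faceH_of_first ι V h hst ht hw fun t' ht' hw' hg' => hex ⟨t', ht', hw', hg'⟩

/-- **(C″) default.** A face that is not the gap face of any dart followed by a free stretch (e.g.
a pocket met only on wired stretches, or a non-exterior face) has `faceH = 0` (an unused value).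
[folklore] -/
theorem collar_faceH_eq_zero {f : ℤ × ℤ}
    (hno : ∀ t, ∀ (ht : t < (cycle V d₀).length), (st (t + 1)).wired = false →
      gapFace (cycle V d₀)[t] ≠ f) :
    (ι.collar V).faceH f = 0 := by
  have hfind : (ι.walk V).find? (fun e => !e.2.2.wired && decide (gapFace e.1 = f)) = none := by
    rw [List.find?_eq_none]
    intro e he
    obtain ⟨t, ht, rfl⟩ := (mem_walk_iff_st ι V h hst).1 he
    cases hwt : (st (t + 1)).wired
    · simpa [hwt] using hno t ht hwt
    · simp
  simp only [LegInsertionData.collar, hfind]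

/-! ### (D) the arc / ghost levels -/

/-- **(D) `vertH` is the value of the FIRST entry mentioning `x`.** If entry `t₀` mentions `x` with
value `ℓ` (`LegInsertionData.mention`, see `mention_of_vertex` / `mention_of_pocketCorner`) and
no earlier entry mentions `x`, then `vertH x = ℓ`. [folklore] -/
theorem collar_vertH_of_first {x : ℤ × ℤ} {t₀ : ℕ} (ht₀ : t₀ < (cycle V d₀).length) {ℓ : ℤ}
    (hm : LegInsertionData.mention V x ((cycle V d₀)[t₀], st t₀, st (t₀ + 1)) = some ℓ)
    (hfirst : ∀ t, ∀ (ht : t < t₀),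
      LegInsertionData.mention V x ((cycle V d₀)[t], st t, st (t + 1)) = none) :
    (ι.collar V).vertH x = ℓ := by
  have ht₀' : t₀ < (ι.walk V).length := (lt_length_walk_iff ι V h).2 ht₀
  have hfind : (ι.walk V).findSome? (LegInsertionData.mention V x) = some ℓ := by
    rw [List.findSome?_eq_some_iff]
    refine ⟨(ι.walk V).take t₀, (ι.walk V)[t₀], (ι.walk V).drop (t₀ + 1), ?_, ?_, ?_⟩
    · rw [List.getElem_cons_drop, List.take_append_drop]
    · rwa [getElem_walk_st ι V h hst ht₀']
    · intro e he
      obtain ⟨j, hj, rfl⟩ := List.mem_take_iff_getElem.1 he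
      rw [getElem_walk_st ι V h hst (by omega)]
      exact hfirst j (by omega)
  simp only [LegInsertionData.collar, hfind, Option.getD_some]

/-- **(D′) `vertH` when all earlier mentions agree.** If entry `t` mentions `x` with value `ℓ` and
every earlier entry mentioning `x` mentions it with the same value, then `vertH x = ℓ`. [folklore] -/
theorem collar_vertH_eq {x : ℤ × ℤ} {t : ℕ} (ht : t < (cycle V d₀).length) {ℓ : ℤ}
    (hm : LegInsertionData.mention V x ((cycle V d₀)[t], st t, st (t + 1)) = some ℓ)
    (hsame : ∀ t', ∀ (ht' : t' < t), ∀ ℓ',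
      LegInsertionData.mention V x ((cycle V d₀)[t'], st t', st (t' + 1)) = some ℓ' → ℓ' = ℓ) :
    (ι.collar V).vertH x = ℓ := by
  induction t using Nat.strong_induction_on with
  | _ t ih =>
    by_cases hex : ∃ t', ∃ (ht' : t' < t),
        LegInsertionData.mention V x ((cycle V d₀)[t'], st t', st (t' + 1)) ≠ none
    · obtain ⟨t', ht', hm'⟩ := hex
      obtain ⟨ℓ', hℓ'⟩ := Option.ne_none_iff_exists'.1 hm'
      obtain rfl := hsame t' ht' ℓ' hℓ'
      exact ih t' ht' (by omega) hℓ' fun t'' ht'' ℓ'' h'' => hsame t'' (by omega) ℓ'' h''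
    · exact collar_vertH_of_first ι V h hst ht hm fun t' ht' =>
        Classical.byContradiction fun hne => hex ⟨t', ht', hne⟩

/-- **(D″) default.** A point mentioned by no entry (a free vertex, a far lattice point) has
`vertH = 0` (an unused value). [folklore] -/
theorem collar_vertH_eq_zero {x : ℤ × ℤ}
    (hno : ∀ t, ∀ (ht : t < (cycle V d₀).length),
      LegInsertionData.mention V x ((cycle V d₀)[t], st t, st (t + 1)) = none) :
    (ι.collar V).vertH x = 0 := by
  have hfind : (ι.walk V).findSome? (LegInsertionData.mention V x) = none := by
    rw [List.findSome?_eq_none_iff]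
    intro e he
    obtain ⟨t, ht, rfl⟩ := (mem_walk_iff_st ι V h hst).1 he
    exact hno t ht
  simp only [LegInsertionData.collar, hfind, Option.getD_none]

end Walk

/-! ### Registered one-line forms -/

/-- **Sub-goal `s12_collarArc`** (registered on stmt-CriticalPhenomena-14132): semantics (A) of the
jump collar — the Dirichlet arc is the set of vertices of boundary darts on wired stretches.
[folklore] -/
theorem s12_collarArc : ∀ (ι : Literature.Probability.LatticeModels.CollarLegModel.LegInsertionData) (V : Finset (ℤ × ℤ)) (d₀ : Literature.Probability.LatticeModels.CollarLegModel.Dart) (st : ℕ → Literature.Probability.LatticeModels.CollarLegModel.WalkState), Literature.Probability.LatticeModels.CollarLegModel.outDart V ι.sink = some d₀ → (∀ t, st t = List.foldl (fun s d ↦ s.step (ι.startAt V d)) ι.init ((Literature.Probability.LatticeModels.CollarLegModel.cycle V d₀).take t)) → ∀ x : ℤ × ℤ, x ∈ (ι.collar V).arc ↔ ∃ (t : ℕ) (_ : t < (Literature.Probability.LatticeModels.CollarLegModel.cycle V d₀).length), ((st t).wired = true ∨ (st (t + 1)).wired = true) ∧ ((Literature.Probability.LatticeModels.CollarLegModel.cycle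 V d₀)[t]).1 = x :=
  fun ι V _ _ h hst _ => mem_collar_arc_iff ι V h hst

/-- **Sub-goal `s12_collarPockets`** (registered on stmt-CriticalPhenomena-14132): semantics (B) of
the jump collar — the pockets are the gap faces after darts followed by a wired stretch. [folklore] -/
theorem s12_collarPockets : ∀ (ι : Literature.Probability.LatticeModels.CollarLegModel.LegInsertionData) (V : Finset (ℤ × ℤ)) (d₀ : Literature.Probability.LatticeModels.CollarLegModel.Dart) (st : ℕ → Literature.Probability.LatticeModels.CollarLegModel.WalkState), Literature.Probability.LatticeModels.CollarLegModel.outDart V ι.sink = some d₀ → (∀ t, st t = List.foldl (fun s d ↦ s.step (ι.startAt V d)) ι.init ((Literature.Probability.LatticeModels.CollarLegModel.cycle V d₀).take t)) → ∀ f : ℤ × ℤ, f ∈ (ι.collar V).pocket ↔ ∃ (t : ℕ) (_ : t < (Literature.Probability.LatticeModels.CollarLegModel.cycle V d₀).length), (st (t + 1)).wired = true ∧ Literature.Probability.LatticeModels.CollarLegModel.gapFace ((Literature.Probability.LatticeModels.CollarLegModel.cycle V d₀)[t]) = f :=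
  fun ι V _ _ h hst _ => mem_collar_pocket_iff ι V h hst

/-- **Sub-goal `s12_collarFaceH`** (registered on stmt-CriticalPhenomena-14132): semantics (C) of
the jump collar — `faceH` of the gap face of dart `t₀` followed by a free stretch is the level after
the FIRST such dart with that gap face; hence `= (st (t + 1)).level` whenever all earlier free darts
with the same gap face carry the same level; and the default `0` for faces never met on a free
stretch. [folklore] -/
theorem s12_collarFaceH : ∀ (ι : Literature.Probability.LatticeModels.CollarLegModel.LegInsertionData) (V : Finset (ℤ × ℤ)) (d₀ : Literature.Probability.LatticeModels.CollarLegModel.Dart) (st : ℕ → Literature.Probability.LatticeModels.CollarLegModel.WalkState), Literature.Probability.LatticeModels.CollarLegModel.outDart V ι.sink = some d₀ → (∀ t, st t = List.foldl (fun s d ↦ s.step (ι.startAt V d)) ι.init ((Literature.Probability.LatticeModels.CollarLegModel.cycle V d₀).take t)) → (∀ (t₀ : ℕ) (ht₀ : t₀ < (Literature.Probability.LatticeModels.CollarLegModel.cycle V d₀).length), (st (t₀ + 1)).wired = false → (∀ t, ∀ (ht : t < t₀), (st (t + 1)).wired = false → Literature.Probability.LatticeModels.CollarLegModel.gapFace ((Literature.Probability.LatticeModels.CollarLegModel.cycle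 V d₀)[t]) ≠ Literature.Probability.LatticeModels.CollarLegModel.gapFace ((Literature.Probability.LatticeModels.CollarLegModel.cycle V d₀)[t₀])) → (ι.collar V).faceH (Literature.Probability.LatticeModels.CollarLegModel.gapFace ((Literature.Probability.LatticeModels.CollarLegModel.cycle V d₀)[t₀])) = (st (t₀ + 1)).level) ∧ (∀ (t : ℕ) (ht : t < (Literature.Probability.LatticeModels.CollarLegModel.cycle V d₀).length), (st (t + 1)).wired = false → (∀ t', ∀ (ht' : t' < t), (st (t' + 1)).wired = false → Literature.Probability.LatticeModels.CollarLegModel.gapFace ((Literature.Probability.LatticeModels.CollarLegModel.cycle V d₀)[t']) = Literature.Probability.LatticeModels.CollarLegModel.gapFace ((Literature.Probability.LatticeModels.CollarLegModel.cycle V d₀)[t]) → (st (t' + 1)).level = (st (t + 1)).level) → (ι.collar V).faceH (Literature.Probability.LatticeModels.CollarLegModel.gapFace ((Literature.Probability.LatticeModels.CollarLegModel.cycle V d₀)[t])) = (st (t + 1)).level) ∧ (∀ f : ℤ × ℤ, (∀ (t : ℕ) (ht : t < (Literature.Probability.LatticeModels.CollarLegModel.cycle V d₀).length), (st (t + 1)).wired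 = false → Literature.Probability.LatticeModels.CollarLegModel.gapFace ((Literature.Probability.LatticeModels.CollarLegModel.cycle V d₀)[t]) ≠ f) → (ι.collar V).faceH f = 0) :=
  fun ι V _ _ h hst => ⟨fun _ ht₀ hw hfirst => collar_faceH_of_first ι V h hst ht₀ hw hfirst,
    fun _ ht hw hsame => collar_faceH_gapFace ι V h hst ht hw hsame,
    fun _ hno => collar_faceH_eq_zero ι V h hst hno⟩

/-- **Sub-goal `s12_collarVertH`** (registered on stmt-CriticalPhenomena-14132): semantics (D) of
the jump collar — `vertH x` is the value of the FIRST walk entry mentioning `x`; hence `= ℓ` whenever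
entry `t` mentions `x` with value `ℓ` and all earlier mentions agree; the default `0`; and the two
clauses of `mention` (wired level at the dart's vertex / tip; pocket level at an outside corner of
the pocket). [folklore] -/
theorem s12_collarVertH : (∀ (ι : Literature.Probability.LatticeModels.CollarLegModel.LegInsertionData) (V : Finset (ℤ × ℤ)) (d₀ : Literature.Probability.LatticeModels.CollarLegModel.Dart) (st : ℕ → Literature.Probability.LatticeModels.CollarLegModel.WalkState), Literature.Probability.LatticeModels.CollarLegModel.outDart V ι.sink = some d₀ → (∀ t, st t = List.foldl (fun s d ↦ s.step (ι.startAt V d)) ι.init ((Literature.Probability.LatticeModels.CollarLegModel.cycle V d₀).take t)) → ∀ (x : ℤ × ℤ) (ℓ : ℤ), (∀ (t₀ : ℕ) (ht₀ : t₀ < (Literature.Probability.LatticeModels.CollarLegModel.cycle V d₀).length), Literature.Probability.LatticeModels.CollarLegModel.LegInsertionData.mention V x ((Literature.Probability.LatticeModels.CollarLegModel.cycle V d₀)[t₀], st t₀, st (t₀ + 1)) = some ℓ → (∀ t, ∀ (ht : t < t₀), Literature.Probability.LatticeModels.CollarLegModel.LegInsertionData.mention V x ((Literature.Probability.LatticeModels.CollarLegModel.cycle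 V d₀)[t], st t, st (t + 1)) = none) → (ι.collar V).vertH x = ℓ) ∧ (∀ (t : ℕ) (ht : t < (Literature.Probability.LatticeModels.CollarLegModel.cycle V d₀).length), Literature.Probability.LatticeModels.CollarLegModel.LegInsertionData.mention V x ((Literature.Probability.LatticeModels.CollarLegModel.cycle V d₀)[t], st t, st (t + 1)) = some ℓ → (∀ t', ∀ (ht' : t' < t), ∀ ℓ', Literature.Probability.LatticeModels.CollarLegModel.LegInsertionData.mention V x ((Literature.Probability.LatticeModels.CollarLegModel.cycle V d₀)[t'], st t', st (t' + 1)) = some ℓ' → ℓ' = ℓ) → (ι.collar V).vertH x = ℓ) ∧ ((∀ (t : ℕ) (ht : t < (Literature.Probability.LatticeModels.CollarLegModel.cycle V d₀).length), Literature.Probability.LatticeModels.CollarLegModel.LegInsertionData.mention V x ((Literature.Probability.LatticeModels.CollarLegModel.cycle V d₀)[t], st t, st (t + 1)) = none) → (ι.collar V).vertH x = 0)) ∧ (∀ (V : Finset (ℤ × ℤ)) (x : ℤ × ℤ) (e : Literature.Probability.LatticeModels.CollarLegModel.Dart × Literature.Probability.LatticeModels.CollarLegModel.WalkState × Literature.Probability.LatticeModels.CollarLegModel.WalkState),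 ((e.2.1.wired = true ∨ e.2.2.wired = true) → (e.1.1 = x ∨ Literature.Probability.LatticeModels.CollarLegModel.dartTip e.1 = x) → Literature.Probability.LatticeModels.CollarLegModel.LegInsertionData.mention V x e = some (if e.2.1.wired = true then e.2.1.level else e.2.2.level)) ∧ ((e.1.1 ≠ x ∧ Literature.Probability.LatticeModels.CollarLegModel.dartTip e.1 ≠ x) → e.2.2.wired = true → x ∈ Literature.Probability.LatticeModels.SixVertex.faceCorners (Literature.Probability.LatticeModels.CollarLegModel.gapFace e.1) → x ∉ V → Literature.Probability.LatticeModels.CollarLegModel.LegInsertionData.mention V x e = some e.2.2.level) ∧ (Literature.Probability.LatticeModels.CollarLegModel.LegInsertionData.mention V x e = none ↔ ¬ ((e.2.1.wired = true ∨ e.2.2.wired = true) ∧ (e.1.1 = x ∨ Literature.Probability.LatticeModels.CollarLegModel.dartTip e.1 = x)) ∧ ¬ (e.2.2.wired = true ∧ x ∈ Literature.Probability.LatticeModels.SixVertex.faceCorners (Literature.Probability.LatticeModels.CollarLegModel.gapFace e.1) ∧ x ∉ V))) :=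
  ⟨fun ι V _ _ h hst _ _ => ⟨fun _ ht₀ hm hfirst => collar_vertH_of_first ι V h hst ht₀ hm hfirst,
    fun _ ht hm hsame => collar_vertH_eq ι V h hst ht hm hsame,
    fun hno => collar_vertH_eq_zero ι V h hst hno⟩,
   fun V _ _ => ⟨mention_of_vertex V, mention_of_pocketCorner V, mention_eq_none_iff V⟩⟩

end Summit.CriticalPhenomena.CardyFormulaZ2.Cruxes.BoundaryDefectGaussianR.RainbowMonomialsInExcursionKernels
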